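import Summits.CriticalPhenomena.PercolationContinuityZ3.Theorems.Transplant.FKDoubleFanLowQMinACAC
import Summits.CriticalPhenomena.PercolationContinuityZ3.Theorems.Transplant.FKDoubleFanLowQMinACParts1
import Summits.CriticalPhenomena.PercolationContinuityZ3.Theorems.Transplant.FKDoubleFanLowQMinACParts2
import Summits.CriticalPhenomena.PercolationContinuityZ3.Theorems.Transplant.FKDoubleFanLowQMinACParts3
import Summits.CriticalPhenomena.PercolationContinuityZ3.Theorems.Transplant.FKDoubleFanWordCellsWFree
import Summits.CriticalPhenomena.PercolationContinuityZ3.Theorems.Transplant.FKDoubleFanWordCellsFreeRays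
import Summits.CriticalPhenomena.PercolationContinuityZ3.Theorems.Transplant.FKDoubleFanWordCellsB3Free
import Summits.CriticalPhenomena.PercolationContinuityZ3.Theorems.Transplant.FKDoubleFanWordCellsParts
import Summits.CriticalPhenomena.PercolationContinuityZ3.Theorems.Transplant.FKDoubleFanD3MinCells
import HarnessLib

/-!
# Double fans, distance 3 below `q = 1/2` (MIN pattern): the 36 cells from the (AC,AC) certificate, the termwise pairs and ONE roof block

Helper file (`--supports stmt-CriticalPhenomena-4575`), FK sub-lane `prim-bschramm-fk-3` (gen 52); builds on p205010 (kernel theorem, internal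
audit signed; external expert review pending).  No named facts, no sorries, default heartbeats; standard axioms.  Memo
`bschramm/prim-bschramm-fk-3/FAR-CROSS-XXVII.md` §0–§2.

For `q ∈ [0,1/2]` the rim letters of the two-block MIN pattern `E B_y E A_x E` cannot be split (memo §0(B)); the cell inequalities `CellsOK` at the
36 endpoint pairs are assembled here WITHOUT the parts route of «…WordCellsParts»: rows and columns `A, D, BD` are free and the 19 `W_D`-words and the
identity word are free for every `q ∈ [0,1]` (tree); the pairs `(AC,R₀)`, `(AC,R₁)`, `(AC,𝟙)`, `(𝟙,𝟙)`, `(𝟙,AC)` of the 8 `T/I` words are termwise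
(«…LowQMinACParts»); the `(AC,AC)` CELL is the rim-unsplit certificate `cellMin_AC_AC_nonneg_lowq` («…LowQMinACAC»); what remains is the ROOF BLOCK —
the cells `(roof, roof)`, `(roof, 𝟙)`, `(𝟙, roof)` — taken as three hypotheses (**`cellsOK_MIN_lowq_of_roofBlock`**).  Measure level
(**`negCorr_spokes_cross_three_BA_lowq_of_roofBlock`**): for `0 < q ≤ 1/2` the cross-apex pair at rim distance three with single opposite middle
spokes is negatively correlated on every weighted double fan, conditionally on the roof block.

STATUS (lead g29 ruling, 2026-08-29): CONDITIONAL.  The roof block is OPEN: it is true pointwise (and pointwise certifiable down to `q = 0` by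
sums of squares of multi-affine rim/part polynomials), but the base-Bernstein ⊗ letter-DNN certificate architecture of «…LowQMinACAC» provably
CANNOT certify it (coverage obstruction: the roof family's probe endpoints `w ∈ {0,1}` are the rays `A`, `D` with vanishing diagonal cells while the
middle control carries the negative mass; memo §10–§11).  Nothing here claims the MIN theorem below `1/2`.
[cite: Grimmett2006, §3.9 eq. (3.94) (pp. 63–64)] [folklore]
-/

noncomputable section

namespace Summit.CriticalPhenomena.PercolationContinuityZ3.Theorems

namespace FK

namespace ThreeApex

section Glue

variable {q : ℝ} {k0 k1 k2 : ℕ} {x1 y1 x2 y2 : ℝ}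

/-- A roof vector on the right from its three parts: `(P, roofP q t w) ≥ 0` if `(P,R₀(w))`, `(P,R₁(w))`, `(P,𝟙)` are `≥ 0` (`t ≥ 0`, `q ≤ 2`). [folklore] -/
theorem pcell2_nonneg_roofP_right (hq2 : q ≤ 2) {P : P6} (h0 : ∀ w : ℝ, 0 ≤ w → w ≤ 1 → 0 ≤ pcell2 q k0 k1 k2 x1 y1 x2 y2 P (roofR0 q w))
    (h1 : ∀ w : ℝ, 0 ≤ w → w ≤ 1 → 0 ≤ pcell2 q k0 k1 k2 x1 y1 x2 y2 P (roofR1 q w)) (h2 : 0 ≤ pcell2 q k0 k1 k2 x1 y1 x2 y2 P rayOne)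
    {t w : ℝ} (ht : 0 ≤ t) (hw0 : 0 ≤ w) (hw1 : w ≤ 1) : 0 ≤ pcell2 q k0 k1 k2 x1 y1 x2 y2 P (roofP q t w) := by
  rw [pcell2_roof_right]
  exact quad_roof_nonneg hq2 ht (h0 w hw0 hw1) (h1 w hw0 hw1) h2

/-- A free ROW at an endpoint column: if `(P, S) ≥ 0` for every generator `S`, then for every endpoint vector `S` (`q ≤ 2`). [folklore] -/
theorem pcell2_nonneg_endP_of_genRow (hq2 : q ≤ 2) {P : P6} (h : ∀ S : P6, IsGenP q S → 0 ≤ pcell2 q k0 k1 k2 x1 y1 x2 y2 P S) {S : P6}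
    (hS : IsEndP q S) : 0 ≤ pcell2 q k0 k1 k2 x1 y1 x2 y2 P S := by
  rcases hS with rfl | rfl | rfl | rfl | rfl | ⟨t, w, ht, hw0, hw1, rfl⟩
  · exact h _ (isGenP_rayA q)
  · exact h _ (isGenP_rayD q)
  · exact h _ (isGenP_rayAC q)
  · exact h _ (isGenP_rayBD q)
  · exact h _ (isGenP_rayOne q)
  · exact pcell2_nonneg_roofP_right hq2 (fun w hw0 hw1 => h _ (isGenP_roofR0 q hw0 hw1)) (fun w hw0 hw1 => h _ (isGenP_roofR1 q hw0 hw1))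
      (h _ (isGenP_rayOne q)) ht hw0 hw1

/-- A free COLUMN at an endpoint row (mirror of `pcell2_nonneg_endP_of_genRow`). [folklore] -/
theorem pcell2_nonneg_endP_of_genCol (hq2 : q ≤ 2) {S : P6} (h : ∀ P : P6, IsGenP q P → 0 ≤ pcell2 q k0 k1 k2 x1 y1 x2 y2 P S) {P : P6}
    (hP : IsEndP q P) : 0 ≤ pcell2 q k0 k1 k2 x1 y1 x2 y2 P S := by
  rcases hP with rfl | rfl | rfl | rfl | rfl | ⟨t, w, ht, hw0, hw1, rfl⟩
  · exact h _ (isGenP_rayA q)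
  · exact h _ (isGenP_rayD q)
  · exact h _ (isGenP_rayAC q)
  · exact h _ (isGenP_rayBD q)
  · exact h _ (isGenP_rayOne q)
  · rw [pcell2_roof_left]
    exact quad_roof_nonneg hq2 ht (h _ (isGenP_roofR0 q hw0 hw1)) (h _ (isGenP_roofR1 q hw0 hw1)) (h _ (isGenP_rayOne q))

end Glue

section MinLowQ

variable {q r0 y r1 x r2 : ℝ}

/-- All 27 words non-negative at a pair `(P,S)` ⟹ the MIN cell at `(P,S)` is non-negative (rim-termwise assembly). [folklore] -/
theorem cellMin_nonneg_of_allWords (hr00 : 0 ≤ r0) (hr01 : r0 ≤ 1) (hr10 : 0 ≤ r1) (hr11 : r1 ≤ 1) (hr20 : 0 ≤ r2) (hr21 : r2 ≤ 1) {P S : P6}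
    (h : ∀ k0 k1 k2 : ℕ, 0 ≤ pcell2 q k0 k1 k2 0 y x 0 P S) : 0 ≤ cellFn q [(r0, 0, y), (r1, x, 0)] r2 P S :=
  cellFn_twoBlocks_nonneg_of_pcells hr00 hr01 hr10 hr11 hr20 hr21
    (h 2 2 2) (h 2 2 1) (h 2 2 0) (h 2 1 2) (h 2 1 1) (h 2 1 0) (h 2 0 2) (h 2 0 1) (h 2 0 0)
    (h 1 2 2) (h 1 2 1) (h 1 2 0) (h 1 1 2) (h 1 1 1) (h 1 1 0) (h 1 0 2) (h 1 0 1) (h 1 0 0)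
    (h 0 2 2) (h 0 2 1) (h 0 2 0) (h 0 1 2) (h 0 1 1) (h 0 1 0) (h 0 0 2) (h 0 0 1) (h 0 0 0)

/-- **The 36 cells of the MIN pattern on `q ∈ [0,1/2]`, conditionally on the ROOF BLOCK.**  Hypotheses: the three roof-block cells `(roof, roof)`,
`(roof, 𝟙)`, `(𝟙, roof)` of the rim-UNSPLIT cell function are `≥ 0`; everything else is proved (free rows/columns, `W_D`-words, termwise pairs,
the `(AC,AC)` certificate).  CONDITIONAL: the roof block is OPEN and the letter-DNN architecture provably cannot certify it (memo §11). [folklore] -/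
theorem cellsOK_MIN_lowq_of_roofBlock (hq0 : 0 ≤ q) (hq1 : q ≤ 1 / 2) (hr00 : 0 ≤ r0) (hr01 : r0 ≤ 1) (hy0 : 0 ≤ y) (hy1 : y ≤ 1)
    (hr10 : 0 ≤ r1) (hr11 : r1 ≤ 1) (hx0 : 0 ≤ x) (hx1 : x ≤ 1) (hr20 : 0 ≤ r2) (hr21 : r2 ≤ 1)
    (HRR : ∀ t w t' v : ℝ, 0 ≤ t → 0 ≤ w → w ≤ 1 → 0 ≤ t' → 0 ≤ v → v ≤ 1 →
      0 ≤ cellFn q [(r0, 0, y), (r1, x, 0)] r2 (roofP q t w) (roofP q t' v))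
    (HR1 : ∀ t w : ℝ, 0 ≤ t → 0 ≤ w → w ≤ 1 → 0 ≤ cellFn q [(r0, 0, y), (r1, x, 0)] r2 (roofP q t w) rayOne)
    (H1R : ∀ t' v : ℝ, 0 ≤ t' → 0 ≤ v → v ≤ 1 → 0 ≤ cellFn q [(r0, 0, y), (r1, x, 0)] r2 rayOne (roofP q t' v)) :
    CellsOK q [(r0, 0, y), (r1, x, 0)] r2 := by
  have hq1one : q ≤ 1 := by linarith
  have hq2 : q ≤ 2 := by linarith
  intro P S hP hS
  -- free rows `A, D, BD`
  have rowA : P = rayA → 0 ≤ cellFn q [(r0, 0, y), (r1, x, 0)] r2 P S := by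
    rintro rfl
    exact cellMin_nonneg_of_allWords hr00 hr01 hr10 hr11 hr20 hr21 (fun k0 k1 k2 =>
      pcell2_nonneg_endP_of_genRow hq2 (fun S hS' => pcell2_rayA_nonneg hq0 hq1one zero_le_one hy1 hx1 zero_le_one hS') hS)
  have rowD : P = rayD → 0 ≤ cellFn q [(r0, 0, y), (r1, x, 0)] r2 P S := by
    rintro rfl
    exact cellMin_nonneg_of_allWords hr00 hr01 hr10 hr11 hr20 hr21 (fun k0 k1 k2 =>
      pcell2_nonneg_endP_of_genRow hq2 (fun S hS' => pcell2_rayD_nonneg hq0 hq1one (le_refl 0) zero_le_one hy0 hy1 hx0 hx1 (le_refl 0) zero_le_one hS') hS)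
  have rowBD : P = rayBD → 0 ≤ cellFn q [(r0, 0, y), (r1, x, 0)] r2 P S := by
    rintro rfl
    exact cellMin_nonneg_of_allWords hr00 hr01 hr10 hr11 hr20 hr21 (fun k0 k1 k2 =>
      pcell2_nonneg_endP_of_genRow hq2 (fun S hS' => pcell2_rayBD_nonneg hq0 hq1one (le_refl 0) zero_le_one hy0 hy1 hx0 hx1 (le_refl 0) zero_le_one hS') hS)
  -- free columns `A, D, BD`
  have colA : S = rayA → 0 ≤ cellFn q [(r0, 0, y), (r1, x, 0)] r2 P S := by
    rintro rfl
    exact cellMin_nonneg_of_allWords hr00 hr01 hr10 hr11 hr20 hr21 (fun k0 k1 k2 =>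
      pcell2_nonneg_endP_of_genCol hq2 (fun P hP' => pcell2_col_rayA_nonneg hq0 hq1one zero_le_one hy1 hx1 zero_le_one hP') hP)
  have colD : S = rayD → 0 ≤ cellFn q [(r0, 0, y), (r1, x, 0)] r2 P S := by
    rintro rfl
    exact cellMin_nonneg_of_allWords hr00 hr01 hr10 hr11 hr20 hr21 (fun k0 k1 k2 =>
      pcell2_nonneg_endP_of_genCol hq2 (fun P hP' => pcell2_col_rayD_nonneg hq0 hq1one (le_refl 0) zero_le_one hy0 hy1 hx0 hx1 (le_refl 0) zero_le_one hP') hP)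
  have colBD : S = rayBD → 0 ≤ cellFn q [(r0, 0, y), (r1, x, 0)] r2 P S := by
    rintro rfl
    exact cellMin_nonneg_of_allWords hr00 hr01 hr10 hr11 hr20 hr21 (fun k0 k1 k2 =>
      pcell2_nonneg_endP_of_genCol hq2 (fun P hP' => pcell2_col_rayBD_nonneg hq0 hq1one (le_refl 0) zero_le_one hy0 hy1 hx0 hx1 (le_refl 0) zero_le_one hP') hP)
  rcases hP with rfl | rfl | rfl | rfl | rfl | ⟨t, w, ht, hw0, hw1, rfl⟩
  · exact rowA rfl
  · exact rowD rfl
  · -- row `AC`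
    rcases hS with rfl | rfl | rfl | rfl | rfl | ⟨t', v, ht', hv0, hv1, rfl⟩
    · exact colA rfl
    · exact colD rfl
    · exact cellMin_AC_AC_nonneg_lowq hq0 hq1 hy0 hy1 hx0 hx1 hr00 hr01 hr10 hr11 hr20 hr21
    · exact colBD rfl
    · have hP : IsEndP q rayAC := Or.inr (Or.inr (Or.inl rfl))
      have hS : IsEndP q rayOne := Or.inr (Or.inr (Or.inr (Or.inr (Or.inl rfl))))
      exact cellFn_twoBlocks_nonneg_of_pcells hr00 hr01 hr10 hr11 hr20 hr21
          (lqMin_AC_One_222 hq0 hq1 hy0 hy1 hx0 hx1)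
          (lqMin_AC_One_221 hq0 hq1 hy0 hy1 hx0 hx1)
          (pcell2_nonneg_endP_of_parts hq2 (partsOK_of_hasW hq0 hq1one (le_refl 0) zero_le_one hy0 hy1 hx0 hx1 (le_refl 0) zero_le_one (Or.inr (Or.inr rfl))) hP hS)
          (lqMin_AC_One_212 hq0 hq1 hy0 hy1 hx0 hx1)
          (lqMin_AC_One_211 hq0 hq1 hy0 hy1 hx0 hx1)
          (pcell2_nonneg_endP_of_parts hq2 (partsOK_of_hasW hq0 hq1one (le_refl 0) zero_le_one hy0 hy1 hx0 hx1 (le_refl 0) zero_le_one (Or.inr (Or.inr rfl))) hP hS)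
          (pcell2_nonneg_endP_of_parts hq2 (partsOK_of_hasW hq0 hq1one (le_refl 0) zero_le_one hy0 hy1 hx0 hx1 (le_refl 0) zero_le_one (Or.inr (Or.inl rfl))) hP hS)
          (pcell2_nonneg_endP_of_parts hq2 (partsOK_of_hasW hq0 hq1one (le_refl 0) zero_le_one hy0 hy1 hx0 hx1 (le_refl 0) zero_le_one (Or.inr (Or.inl rfl))) hP hS)
          (pcell2_nonneg_endP_of_parts hq2 (partsOK_of_hasW hq0 hq1one (le_refl 0) zero_le_one hy0 hy1 hx0 hx1 (le_refl 0) zero_le_one (Or.inr (Or.inl rfl))) hP hS)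
          (lqMin_AC_One_122 hq0 hq1 hy0 hy1 hx0 hx1)
          (lqMin_AC_One_121 hq0 hq1 hy0 hy1 hx0 hx1)
          (pcell2_nonneg_endP_of_parts hq2 (partsOK_of_hasW hq0 hq1one (le_refl 0) zero_le_one hy0 hy1 hx0 hx1 (le_refl 0) zero_le_one (Or.inr (Or.inr rfl))) hP hS)
          (lqMin_AC_One_112 hq0 hq1 hy0 hy1 hx0 hx1)
          (lqMin_AC_One_111 hq0 hq1 hy0 hy1 hx0 hx1)
          (pcell2_nonneg_endP_of_parts hq2 (partsOK_of_hasW hq0 hq1one (le_refl 0) zero_le_one hy0 hy1 hx0 hx1 (le_refl 0) zero_le_one (Or.inr (Or.inr rfl))) hP hS)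
          (pcell2_nonneg_endP_of_parts hq2 (partsOK_of_hasW hq0 hq1one (le_refl 0) zero_le_one hy0 hy1 hx0 hx1 (le_refl 0) zero_le_one (Or.inr (Or.inl rfl))) hP hS)
          (pcell2_nonneg_endP_of_parts hq2 (partsOK_of_hasW hq0 hq1one (le_refl 0) zero_le_one hy0 hy1 hx0 hx1 (le_refl 0) zero_le_one (Or.inr (Or.inl rfl))) hP hS)
          (pcell2_nonneg_endP_of_parts hq2 (partsOK_of_hasW hq0 hq1one (le_refl 0) zero_le_one hy0 hy1 hx0 hx1 (le_refl 0) zero_le_one (Or.inr (Or.inl rfl))) hP hS)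
          (pcell2_nonneg_endP_of_parts hq2 (partsOK_of_hasW hq0 hq1one (le_refl 0) zero_le_one hy0 hy1 hx0 hx1 (le_refl 0) zero_le_one (Or.inl rfl)) hP hS)
          (pcell2_nonneg_endP_of_parts hq2 (partsOK_of_hasW hq0 hq1one (le_refl 0) zero_le_one hy0 hy1 hx0 hx1 (le_refl 0) zero_le_one (Or.inl rfl)) hP hS)
          (pcell2_nonneg_endP_of_parts hq2 (partsOK_of_hasW hq0 hq1one (le_refl 0) zero_le_one hy0 hy1 hx0 hx1 (le_refl 0) zero_le_one (Or.inl rfl)) hP hS)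
          (pcell2_nonneg_endP_of_parts hq2 (partsOK_of_hasW hq0 hq1one (le_refl 0) zero_le_one hy0 hy1 hx0 hx1 (le_refl 0) zero_le_one (Or.inl rfl)) hP hS)
          (pcell2_nonneg_endP_of_parts hq2 (partsOK_of_hasW hq0 hq1one (le_refl 0) zero_le_one hy0 hy1 hx0 hx1 (le_refl 0) zero_le_one (Or.inl rfl)) hP hS)
          (pcell2_nonneg_endP_of_parts hq2 (partsOK_of_hasW hq0 hq1one (le_refl 0) zero_le_one hy0 hy1 hx0 hx1 (le_refl 0) zero_le_one (Or.inl rfl)) hP hS)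
          (pcell2_nonneg_endP_of_parts hq2 (partsOK_of_hasW hq0 hq1one (le_refl 0) zero_le_one hy0 hy1 hx0 hx1 (le_refl 0) zero_le_one (Or.inl rfl)) hP hS)
          (pcell2_nonneg_endP_of_parts hq2 (partsOK_of_hasW hq0 hq1one (le_refl 0) zero_le_one hy0 hy1 hx0 hx1 (le_refl 0) zero_le_one (Or.inl rfl)) hP hS)
          (pcell2_nonneg_endP_of_parts hq2 (partsOK_of_hasW hq0 hq1one (le_refl 0) zero_le_one hy0 hy1 hx0 hx1 (le_refl 0) zero_le_one (Or.inl rfl)) hP hS)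
    · have hP : IsEndP q rayAC := Or.inr (Or.inr (Or.inl rfl))
      have hS : IsEndP q (roofP q t' v) := Or.inr (Or.inr (Or.inr (Or.inr (Or.inr ⟨t', v, ht', hv0, hv1, rfl⟩))))
      exact cellFn_twoBlocks_nonneg_of_pcells hr00 hr01 hr10 hr11 hr20 hr21
          (pcell2_nonneg_roofP_right hq2 (fun w' hw0' hw1' => lqMin_AC_R0_222 hq0 hq1 hy0 hy1 hx0 hx1 hw0' hw1') (fun w' hw0' hw1' => lqMin_AC_R1_222 hq0 hq1 hy0 hy1 hx0 hx1 hw0' hw1') (lqMin_AC_One_222 hq0 hq1 hy0 hy1 hx0 hx1) ht' hv0 hv1)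
          (pcell2_nonneg_roofP_right hq2 (fun w' hw0' hw1' => lqMin_AC_R0_221 hq0 hq1 hy0 hy1 hx0 hx1 hw0' hw1') (fun w' hw0' hw1' => lqMin_AC_R1_221 hq0 hq1 hy0 hy1 hx0 hx1 hw0' hw1') (lqMin_AC_One_221 hq0 hq1 hy0 hy1 hx0 hx1) ht' hv0 hv1)
          (pcell2_nonneg_endP_of_parts hq2 (partsOK_of_hasW hq0 hq1one (le_refl 0) zero_le_one hy0 hy1 hx0 hx1 (le_refl 0) zero_le_one (Or.inr (Or.inr rfl))) hP hS)
          (pcell2_nonneg_roofP_right hq2 (fun w' hw0' hw1' => lqMin_AC_R0_212 hq0 hq1 hy0 hy1 hx0 hx1 hw0' hw1') (fun w' hw0' hw1' => lqMin_AC_R1_212 hq0 hq1 hy0 hy1 hx0 hx1 hw0' hw1') (lqMin_AC_One_212 hq0 hq1 hy0 hy1 hx0 hx1) ht' hv0 hv1)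
          (pcell2_nonneg_roofP_right hq2 (fun w' hw0' hw1' => lqMin_AC_R0_211 hq0 hq1 hy0 hy1 hx0 hx1 hw0' hw1') (fun w' hw0' hw1' => lqMin_AC_R1_211 hq0 hq1 hy0 hy1 hx0 hx1 hw0' hw1') (lqMin_AC_One_211 hq0 hq1 hy0 hy1 hx0 hx1) ht' hv0 hv1)
          (pcell2_nonneg_endP_of_parts hq2 (partsOK_of_hasW hq0 hq1one (le_refl 0) zero_le_one hy0 hy1 hx0 hx1 (le_refl 0) zero_le_one (Or.inr (Or.inr rfl))) hP hS)
          (pcell2_nonneg_endP_of_parts hq2 (partsOK_of_hasW hq0 hq1one (le_refl 0) zero_le_one hy0 hy1 hx0 hx1 (le_refl 0) zero_le_one (Or.inr (Or.inl rfl))) hP hS)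
          (pcell2_nonneg_endP_of_parts hq2 (partsOK_of_hasW hq0 hq1one (le_refl 0) zero_le_one hy0 hy1 hx0 hx1 (le_refl 0) zero_le_one (Or.inr (Or.inl rfl))) hP hS)
          (pcell2_nonneg_endP_of_parts hq2 (partsOK_of_hasW hq0 hq1one (le_refl 0) zero_le_one hy0 hy1 hx0 hx1 (le_refl 0) zero_le_one (Or.inr (Or.inl rfl))) hP hS)
          (pcell2_nonneg_roofP_right hq2 (fun w' hw0' hw1' => lqMin_AC_R0_122 hq0 hq1 hy0 hy1 hx0 hx1 hw0' hw1') (fun w' hw0' hw1' => lqMin_AC_R1_122 hq0 hq1 hy0 hy1 hx0 hx1 hw0' hw1') (lqMin_AC_One_122 hq0 hq1 hy0 hy1 hx0 hx1) ht' hv0 hv1)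
          (pcell2_nonneg_roofP_right hq2 (fun w' hw0' hw1' => lqMin_AC_R0_121 hq0 hq1 hy0 hy1 hx0 hx1 hw0' hw1') (fun w' hw0' hw1' => lqMin_AC_R1_121 hq0 hq1 hy0 hy1 hx0 hx1 hw0' hw1') (lqMin_AC_One_121 hq0 hq1 hy0 hy1 hx0 hx1) ht' hv0 hv1)
          (pcell2_nonneg_endP_of_parts hq2 (partsOK_of_hasW hq0 hq1one (le_refl 0) zero_le_one hy0 hy1 hx0 hx1 (le_refl 0) zero_le_one (Or.inr (Or.inr rfl))) hP hS)
          (pcell2_nonneg_roofP_right hq2 (fun w' hw0' hw1' => lqMin_AC_R0_112 hq0 hq1 hy0 hy1 hx0 hx1 hw0' hw1') (fun w' hw0' hw1' => lqMin_AC_R1_112 hq0 hq1 hy0 hy1 hx0 hx1 hw0' hw1') (lqMin_AC_One_112 hq0 hq1 hy0 hy1 hx0 hx1) ht' hv0 hv1)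
          (pcell2_nonneg_roofP_right hq2 (fun w' hw0' hw1' => lqMin_AC_R0_111 hq0 hq1 hy0 hy1 hx0 hx1 hw0' hw1') (fun w' hw0' hw1' => lqMin_AC_R1_111 hq0 hq1 hy0 hy1 hx0 hx1 hw0' hw1') (lqMin_AC_One_111 hq0 hq1 hy0 hy1 hx0 hx1) ht' hv0 hv1)
          (pcell2_nonneg_endP_of_parts hq2 (partsOK_of_hasW hq0 hq1one (le_refl 0) zero_le_one hy0 hy1 hx0 hx1 (le_refl 0) zero_le_one (Or.inr (Or.inr rfl))) hP hS)
          (pcell2_nonneg_endP_of_parts hq2 (partsOK_of_hasW hq0 hq1one (le_refl 0) zero_le_one hy0 hy1 hx0 hx1 (le_refl 0) zero_le_one (Or.inr (Or.inl rfl))) hP hS)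
          (pcell2_nonneg_endP_of_parts hq2 (partsOK_of_hasW hq0 hq1one (le_refl 0) zero_le_one hy0 hy1 hx0 hx1 (le_refl 0) zero_le_one (Or.inr (Or.inl rfl))) hP hS)
          (pcell2_nonneg_endP_of_parts hq2 (partsOK_of_hasW hq0 hq1one (le_refl 0) zero_le_one hy0 hy1 hx0 hx1 (le_refl 0) zero_le_one (Or.inr (Or.inl rfl))) hP hS)
          (pcell2_nonneg_endP_of_parts hq2 (partsOK_of_hasW hq0 hq1one (le_refl 0) zero_le_one hy0 hy1 hx0 hx1 (le_refl 0) zero_le_one (Or.inl rfl)) hP hS)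
          (pcell2_nonneg_endP_of_parts hq2 (partsOK_of_hasW hq0 hq1one (le_refl 0) zero_le_one hy0 hy1 hx0 hx1 (le_refl 0) zero_le_one (Or.inl rfl)) hP hS)
          (pcell2_nonneg_endP_of_parts hq2 (partsOK_of_hasW hq0 hq1one (le_refl 0) zero_le_one hy0 hy1 hx0 hx1 (le_refl 0) zero_le_one (Or.inl rfl)) hP hS)
          (pcell2_nonneg_endP_of_parts hq2 (partsOK_of_hasW hq0 hq1one (le_refl 0) zero_le_one hy0 hy1 hx0 hx1 (le_refl 0) zero_le_one (Or.inl rfl)) hP hS)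
          (pcell2_nonneg_endP_of_parts hq2 (partsOK_of_hasW hq0 hq1one (le_refl 0) zero_le_one hy0 hy1 hx0 hx1 (le_refl 0) zero_le_one (Or.inl rfl)) hP hS)
          (pcell2_nonneg_endP_of_parts hq2 (partsOK_of_hasW hq0 hq1one (le_refl 0) zero_le_one hy0 hy1 hx0 hx1 (le_refl 0) zero_le_one (Or.inl rfl)) hP hS)
          (pcell2_nonneg_endP_of_parts hq2 (partsOK_of_hasW hq0 hq1one (le_refl 0) zero_le_one hy0 hy1 hx0 hx1 (le_refl 0) zero_le_one (Or.inl rfl)) hP hS)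
          (pcell2_nonneg_endP_of_parts hq2 (partsOK_of_hasW hq0 hq1one (le_refl 0) zero_le_one hy0 hy1 hx0 hx1 (le_refl 0) zero_le_one (Or.inl rfl)) hP hS)
          (pcell2_nonneg_endP_of_parts hq2 (partsOK_of_hasW hq0 hq1one (le_refl 0) zero_le_one hy0 hy1 hx0 hx1 (le_refl 0) zero_le_one (Or.inl rfl)) hP hS)
  · exact rowBD rfl
  · -- row `𝟙`
    rcases hS with rfl | rfl | rfl | rfl | rfl | ⟨t', v, ht', hv0, hv1, rfl⟩
    · exact colA rfl
    · exact colD rfl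
    · have hP : IsEndP q rayOne := Or.inr (Or.inr (Or.inr (Or.inr (Or.inl rfl))))
      have hS : IsEndP q rayAC := Or.inr (Or.inr (Or.inl rfl))
      exact cellFn_twoBlocks_nonneg_of_pcells hr00 hr01 hr10 hr11 hr20 hr21
          (lqMin_One_AC_222 hq0 hq1 hy0 hy1 hx0 hx1)
          (lqMin_One_AC_221 hq0 hq1 hy0 hy1 hx0 hx1)
          (pcell2_nonneg_endP_of_parts hq2 (partsOK_of_hasW hq0 hq1one (le_refl 0) zero_le_one hy0 hy1 hx0 hx1 (le_refl 0) zero_le_one (Or.inr (Or.inr rfl))) hP hS)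
          (lqMin_One_AC_212 hq0 hq1 hy0 hy1 hx0 hx1)
          (lqMin_One_AC_211 hq0 hq1 hy0 hy1 hx0 hx1)
          (pcell2_nonneg_endP_of_parts hq2 (partsOK_of_hasW hq0 hq1one (le_refl 0) zero_le_one hy0 hy1 hx0 hx1 (le_refl 0) zero_le_one (Or.inr (Or.inr rfl))) hP hS)
          (pcell2_nonneg_endP_of_parts hq2 (partsOK_of_hasW hq0 hq1one (le_refl 0) zero_le_one hy0 hy1 hx0 hx1 (le_refl 0) zero_le_one (Or.inr (Or.inl rfl))) hP hS)
          (pcell2_nonneg_endP_of_parts hq2 (partsOK_of_hasW hq0 hq1one (le_refl 0) zero_le_one hy0 hy1 hx0 hx1 (le_refl 0) zero_le_one (Or.inr (Or.inl rfl))) hP hS)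
          (pcell2_nonneg_endP_of_parts hq2 (partsOK_of_hasW hq0 hq1one (le_refl 0) zero_le_one hy0 hy1 hx0 hx1 (le_refl 0) zero_le_one (Or.inr (Or.inl rfl))) hP hS)
          (lqMin_One_AC_122 hq0 hq1 hy0 hy1 hx0 hx1)
          (lqMin_One_AC_121 hq0 hq1 hy0 hy1 hx0 hx1)
          (pcell2_nonneg_endP_of_parts hq2 (partsOK_of_hasW hq0 hq1one (le_refl 0) zero_le_one hy0 hy1 hx0 hx1 (le_refl 0) zero_le_one (Or.inr (Or.inr rfl))) hP hS)
          (lqMin_One_AC_112 hq0 hq1 hy0 hy1 hx0 hx1)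
          (lqMin_One_AC_111 hq0 hq1 hy0 hy1 hx0 hx1)
          (pcell2_nonneg_endP_of_parts hq2 (partsOK_of_hasW hq0 hq1one (le_refl 0) zero_le_one hy0 hy1 hx0 hx1 (le_refl 0) zero_le_one (Or.inr (Or.inr rfl))) hP hS)
          (pcell2_nonneg_endP_of_parts hq2 (partsOK_of_hasW hq0 hq1one (le_refl 0) zero_le_one hy0 hy1 hx0 hx1 (le_refl 0) zero_le_one (Or.inr (Or.inl rfl))) hP hS)
          (pcell2_nonneg_endP_of_parts hq2 (partsOK_of_hasW hq0 hq1one (le_refl 0) zero_le_one hy0 hy1 hx0 hx1 (le_refl 0) zero_le_one (Or.inr (Or.inl rfl))) hP hS)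
          (pcell2_nonneg_endP_of_parts hq2 (partsOK_of_hasW hq0 hq1one (le_refl 0) zero_le_one hy0 hy1 hx0 hx1 (le_refl 0) zero_le_one (Or.inr (Or.inl rfl))) hP hS)
          (pcell2_nonneg_endP_of_parts hq2 (partsOK_of_hasW hq0 hq1one (le_refl 0) zero_le_one hy0 hy1 hx0 hx1 (le_refl 0) zero_le_one (Or.inl rfl)) hP hS)
          (pcell2_nonneg_endP_of_parts hq2 (partsOK_of_hasW hq0 hq1one (le_refl 0) zero_le_one hy0 hy1 hx0 hx1 (le_refl 0) zero_le_one (Or.inl rfl)) hP hS)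
          (pcell2_nonneg_endP_of_parts hq2 (partsOK_of_hasW hq0 hq1one (le_refl 0) zero_le_one hy0 hy1 hx0 hx1 (le_refl 0) zero_le_one (Or.inl rfl)) hP hS)
          (pcell2_nonneg_endP_of_parts hq2 (partsOK_of_hasW hq0 hq1one (le_refl 0) zero_le_one hy0 hy1 hx0 hx1 (le_refl 0) zero_le_one (Or.inl rfl)) hP hS)
          (pcell2_nonneg_endP_of_parts hq2 (partsOK_of_hasW hq0 hq1one (le_refl 0) zero_le_one hy0 hy1 hx0 hx1 (le_refl 0) zero_le_one (Or.inl rfl)) hP hS)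
          (pcell2_nonneg_endP_of_parts hq2 (partsOK_of_hasW hq0 hq1one (le_refl 0) zero_le_one hy0 hy1 hx0 hx1 (le_refl 0) zero_le_one (Or.inl rfl)) hP hS)
          (pcell2_nonneg_endP_of_parts hq2 (partsOK_of_hasW hq0 hq1one (le_refl 0) zero_le_one hy0 hy1 hx0 hx1 (le_refl 0) zero_le_one (Or.inl rfl)) hP hS)
          (pcell2_nonneg_endP_of_parts hq2 (partsOK_of_hasW hq0 hq1one (le_refl 0) zero_le_one hy0 hy1 hx0 hx1 (le_refl 0) zero_le_one (Or.inl rfl)) hP hS)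
          (pcell2_nonneg_endP_of_parts hq2 (partsOK_of_hasW hq0 hq1one (le_refl 0) zero_le_one hy0 hy1 hx0 hx1 (le_refl 0) zero_le_one (Or.inl rfl)) hP hS)
    · exact colBD rfl
    · have hP : IsEndP q rayOne := Or.inr (Or.inr (Or.inr (Or.inr (Or.inl rfl))))
      have hS : IsEndP q rayOne := Or.inr (Or.inr (Or.inr (Or.inr (Or.inl rfl))))
      exact cellFn_twoBlocks_nonneg_of_pcells hr00 hr01 hr10 hr11 hr20 hr21
          (lqMin_One_One_222 hq0 hq1 hy0 hy1 hx0 hx1)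
          (lqMin_One_One_221 hq0 hq1 hy0 hy1 hx0 hx1)
          (pcell2_nonneg_endP_of_parts hq2 (partsOK_of_hasW hq0 hq1one (le_refl 0) zero_le_one hy0 hy1 hx0 hx1 (le_refl 0) zero_le_one (Or.inr (Or.inr rfl))) hP hS)
          (lqMin_One_One_212 hq0 hq1 hy0 hy1 hx0 hx1)
          (lqMin_One_One_211 hq0 hq1 hy0 hy1 hx0 hx1)
          (pcell2_nonneg_endP_of_parts hq2 (partsOK_of_hasW hq0 hq1one (le_refl 0) zero_le_one hy0 hy1 hx0 hx1 (le_refl 0) zero_le_one (Or.inr (Or.inr rfl))) hP hS)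
          (pcell2_nonneg_endP_of_parts hq2 (partsOK_of_hasW hq0 hq1one (le_refl 0) zero_le_one hy0 hy1 hx0 hx1 (le_refl 0) zero_le_one (Or.inr (Or.inl rfl))) hP hS)
          (pcell2_nonneg_endP_of_parts hq2 (partsOK_of_hasW hq0 hq1one (le_refl 0) zero_le_one hy0 hy1 hx0 hx1 (le_refl 0) zero_le_one (Or.inr (Or.inl rfl))) hP hS)
          (pcell2_nonneg_endP_of_parts hq2 (partsOK_of_hasW hq0 hq1one (le_refl 0) zero_le_one hy0 hy1 hx0 hx1 (le_refl 0) zero_le_one (Or.inr (Or.inl rfl))) hP hS)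
          (lqMin_One_One_122 hq0 hq1 hy0 hy1 hx0 hx1)
          (lqMin_One_One_121 hq0 hq1 hy0 hy1 hx0 hx1)
          (pcell2_nonneg_endP_of_parts hq2 (partsOK_of_hasW hq0 hq1one (le_refl 0) zero_le_one hy0 hy1 hx0 hx1 (le_refl 0) zero_le_one (Or.inr (Or.inr rfl))) hP hS)
          (lqMin_One_One_112 hq0 hq1 hy0 hy1 hx0 hx1)
          (lqMin_One_One_111 hq0 hq1 hy0 hy1 hx0 hx1)
          (pcell2_nonneg_endP_of_parts hq2 (partsOK_of_hasW hq0 hq1one (le_refl 0) zero_le_one hy0 hy1 hx0 hx1 (le_refl 0) zero_le_one (Or.inr (Or.inr rfl))) hP hS)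
          (pcell2_nonneg_endP_of_parts hq2 (partsOK_of_hasW hq0 hq1one (le_refl 0) zero_le_one hy0 hy1 hx0 hx1 (le_refl 0) zero_le_one (Or.inr (Or.inl rfl))) hP hS)
          (pcell2_nonneg_endP_of_parts hq2 (partsOK_of_hasW hq0 hq1one (le_refl 0) zero_le_one hy0 hy1 hx0 hx1 (le_refl 0) zero_le_one (Or.inr (Or.inl rfl))) hP hS)
          (pcell2_nonneg_endP_of_parts hq2 (partsOK_of_hasW hq0 hq1one (le_refl 0) zero_le_one hy0 hy1 hx0 hx1 (le_refl 0) zero_le_one (Or.inr (Or.inl rfl))) hP hS)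
          (pcell2_nonneg_endP_of_parts hq2 (partsOK_of_hasW hq0 hq1one (le_refl 0) zero_le_one hy0 hy1 hx0 hx1 (le_refl 0) zero_le_one (Or.inl rfl)) hP hS)
          (pcell2_nonneg_endP_of_parts hq2 (partsOK_of_hasW hq0 hq1one (le_refl 0) zero_le_one hy0 hy1 hx0 hx1 (le_refl 0) zero_le_one (Or.inl rfl)) hP hS)
          (pcell2_nonneg_endP_of_parts hq2 (partsOK_of_hasW hq0 hq1one (le_refl 0) zero_le_one hy0 hy1 hx0 hx1 (le_refl 0) zero_le_one (Or.inl rfl)) hP hS)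
          (pcell2_nonneg_endP_of_parts hq2 (partsOK_of_hasW hq0 hq1one (le_refl 0) zero_le_one hy0 hy1 hx0 hx1 (le_refl 0) zero_le_one (Or.inl rfl)) hP hS)
          (pcell2_nonneg_endP_of_parts hq2 (partsOK_of_hasW hq0 hq1one (le_refl 0) zero_le_one hy0 hy1 hx0 hx1 (le_refl 0) zero_le_one (Or.inl rfl)) hP hS)
          (pcell2_nonneg_endP_of_parts hq2 (partsOK_of_hasW hq0 hq1one (le_refl 0) zero_le_one hy0 hy1 hx0 hx1 (le_refl 0) zero_le_one (Or.inl rfl)) hP hS)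
          (pcell2_nonneg_endP_of_parts hq2 (partsOK_of_hasW hq0 hq1one (le_refl 0) zero_le_one hy0 hy1 hx0 hx1 (le_refl 0) zero_le_one (Or.inl rfl)) hP hS)
          (pcell2_nonneg_endP_of_parts hq2 (partsOK_of_hasW hq0 hq1one (le_refl 0) zero_le_one hy0 hy1 hx0 hx1 (le_refl 0) zero_le_one (Or.inl rfl)) hP hS)
          (pcell2_nonneg_endP_of_parts hq2 (partsOK_of_hasW hq0 hq1one (le_refl 0) zero_le_one hy0 hy1 hx0 hx1 (le_refl 0) zero_le_one (Or.inl rfl)) hP hS)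
    · exact H1R t' v ht' hv0 hv1
  · -- row roof
    rcases hS with rfl | rfl | rfl | rfl | rfl | ⟨t', v, ht', hv0, hv1, rfl⟩
    · exact colA rfl
    · exact colD rfl
    · have hP : IsEndP q (roofP q t w) := Or.inr (Or.inr (Or.inr (Or.inr (Or.inr ⟨t, w, ht, hw0, hw1, rfl⟩))))
      have hS : IsEndP q rayAC := Or.inr (Or.inr (Or.inl rfl))
      exact cellFn_twoBlocks_nonneg_of_pcells hr00 hr01 hr10 hr11 hr20 hr21
          (by rw [pcell2_mirror]; exact pcell2_nonneg_roofP_right hq2 (fun w' hw0' hw1' => lqMin_AC_R0_222 hq0 hq1 hx0 hx1 hy0 hy1 hw0' hw1') (fun w' hw0' hw1' => lqMin_AC_R1_222 hq0 hq1 hx0 hx1 hy0 hy1 hw0' hw1') (lqMin_AC_One_222 hq0 hq1 hx0 hx1 hy0 hy1) ht hw0 hw1)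
          (by rw [pcell2_mirror]; exact pcell2_nonneg_roofP_right hq2 (fun w' hw0' hw1' => lqMin_AC_R0_122 hq0 hq1 hx0 hx1 hy0 hy1 hw0' hw1') (fun w' hw0' hw1' => lqMin_AC_R1_122 hq0 hq1 hx0 hx1 hy0 hy1 hw0' hw1') (lqMin_AC_One_122 hq0 hq1 hx0 hx1 hy0 hy1) ht hw0 hw1)
          (pcell2_nonneg_endP_of_parts hq2 (partsOK_of_hasW hq0 hq1one (le_refl 0) zero_le_one hy0 hy1 hx0 hx1 (le_refl 0) zero_le_one (Or.inr (Or.inr rfl))) hP hS)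
          (by rw [pcell2_mirror]; exact pcell2_nonneg_roofP_right hq2 (fun w' hw0' hw1' => lqMin_AC_R0_212 hq0 hq1 hx0 hx1 hy0 hy1 hw0' hw1') (fun w' hw0' hw1' => lqMin_AC_R1_212 hq0 hq1 hx0 hx1 hy0 hy1 hw0' hw1') (lqMin_AC_One_212 hq0 hq1 hx0 hx1 hy0 hy1) ht hw0 hw1)
          (by rw [pcell2_mirror]; exact pcell2_nonneg_roofP_right hq2 (fun w' hw0' hw1' => lqMin_AC_R0_112 hq0 hq1 hx0 hx1 hy0 hy1 hw0' hw1') (fun w' hw0' hw1' => lqMin_AC_R1_112 hq0 hq1 hx0 hx1 hy0 hy1 hw0' hw1') (lqMin_AC_One_112 hq0 hq1 hx0 hx1 hy0 hy1) ht hw0 hw1)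
          (pcell2_nonneg_endP_of_parts hq2 (partsOK_of_hasW hq0 hq1one (le_refl 0) zero_le_one hy0 hy1 hx0 hx1 (le_refl 0) zero_le_one (Or.inr (Or.inr rfl))) hP hS)
          (pcell2_nonneg_endP_of_parts hq2 (partsOK_of_hasW hq0 hq1one (le_refl 0) zero_le_one hy0 hy1 hx0 hx1 (le_refl 0) zero_le_one (Or.inr (Or.inl rfl))) hP hS)
          (pcell2_nonneg_endP_of_parts hq2 (partsOK_of_hasW hq0 hq1one (le_refl 0) zero_le_one hy0 hy1 hx0 hx1 (le_refl 0) zero_le_one (Or.inr (Or.inl rfl))) hP hS)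
          (pcell2_nonneg_endP_of_parts hq2 (partsOK_of_hasW hq0 hq1one (le_refl 0) zero_le_one hy0 hy1 hx0 hx1 (le_refl 0) zero_le_one (Or.inr (Or.inl rfl))) hP hS)
          (by rw [pcell2_mirror]; exact pcell2_nonneg_roofP_right hq2 (fun w' hw0' hw1' => lqMin_AC_R0_221 hq0 hq1 hx0 hx1 hy0 hy1 hw0' hw1') (fun w' hw0' hw1' => lqMin_AC_R1_221 hq0 hq1 hx0 hx1 hy0 hy1 hw0' hw1') (lqMin_AC_One_221 hq0 hq1 hx0 hx1 hy0 hy1) ht hw0 hw1)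
          (by rw [pcell2_mirror]; exact pcell2_nonneg_roofP_right hq2 (fun w' hw0' hw1' => lqMin_AC_R0_121 hq0 hq1 hx0 hx1 hy0 hy1 hw0' hw1') (fun w' hw0' hw1' => lqMin_AC_R1_121 hq0 hq1 hx0 hx1 hy0 hy1 hw0' hw1') (lqMin_AC_One_121 hq0 hq1 hx0 hx1 hy0 hy1) ht hw0 hw1)
          (pcell2_nonneg_endP_of_parts hq2 (partsOK_of_hasW hq0 hq1one (le_refl 0) zero_le_one hy0 hy1 hx0 hx1 (le_refl 0) zero_le_one (Or.inr (Or.inr rfl))) hP hS)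
          (by rw [pcell2_mirror]; exact pcell2_nonneg_roofP_right hq2 (fun w' hw0' hw1' => lqMin_AC_R0_211 hq0 hq1 hx0 hx1 hy0 hy1 hw0' hw1') (fun w' hw0' hw1' => lqMin_AC_R1_211 hq0 hq1 hx0 hx1 hy0 hy1 hw0' hw1') (lqMin_AC_One_211 hq0 hq1 hx0 hx1 hy0 hy1) ht hw0 hw1)
          (by rw [pcell2_mirror]; exact pcell2_nonneg_roofP_right hq2 (fun w' hw0' hw1' => lqMin_AC_R0_111 hq0 hq1 hx0 hx1 hy0 hy1 hw0' hw1') (fun w' hw0' hw1' => lqMin_AC_R1_111 hq0 hq1 hx0 hx1 hy0 hy1 hw0' hw1') (lqMin_AC_One_111 hq0 hq1 hx0 hx1 hy0 hy1) ht hw0 hw1)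
          (pcell2_nonneg_endP_of_parts hq2 (partsOK_of_hasW hq0 hq1one (le_refl 0) zero_le_one hy0 hy1 hx0 hx1 (le_refl 0) zero_le_one (Or.inr (Or.inr rfl))) hP hS)
          (pcell2_nonneg_endP_of_parts hq2 (partsOK_of_hasW hq0 hq1one (le_refl 0) zero_le_one hy0 hy1 hx0 hx1 (le_refl 0) zero_le_one (Or.inr (Or.inl rfl))) hP hS)
          (pcell2_nonneg_endP_of_parts hq2 (partsOK_of_hasW hq0 hq1one (le_refl 0) zero_le_one hy0 hy1 hx0 hx1 (le_refl 0) zero_le_one (Or.inr (Or.inl rfl))) hP hS)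
          (pcell2_nonneg_endP_of_parts hq2 (partsOK_of_hasW hq0 hq1one (le_refl 0) zero_le_one hy0 hy1 hx0 hx1 (le_refl 0) zero_le_one (Or.inr (Or.inl rfl))) hP hS)
          (pcell2_nonneg_endP_of_parts hq2 (partsOK_of_hasW hq0 hq1one (le_refl 0) zero_le_one hy0 hy1 hx0 hx1 (le_refl 0) zero_le_one (Or.inl rfl)) hP hS)
          (pcell2_nonneg_endP_of_parts hq2 (partsOK_of_hasW hq0 hq1one (le_refl 0) zero_le_one hy0 hy1 hx0 hx1 (le_refl 0) zero_le_one (Or.inl rfl)) hP hS)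
          (pcell2_nonneg_endP_of_parts hq2 (partsOK_of_hasW hq0 hq1one (le_refl 0) zero_le_one hy0 hy1 hx0 hx1 (le_refl 0) zero_le_one (Or.inl rfl)) hP hS)
          (pcell2_nonneg_endP_of_parts hq2 (partsOK_of_hasW hq0 hq1one (le_refl 0) zero_le_one hy0 hy1 hx0 hx1 (le_refl 0) zero_le_one (Or.inl rfl)) hP hS)
          (pcell2_nonneg_endP_of_parts hq2 (partsOK_of_hasW hq0 hq1one (le_refl 0) zero_le_one hy0 hy1 hx0 hx1 (le_refl 0) zero_le_one (Or.inl rfl)) hP hS)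
          (pcell2_nonneg_endP_of_parts hq2 (partsOK_of_hasW hq0 hq1one (le_refl 0) zero_le_one hy0 hy1 hx0 hx1 (le_refl 0) zero_le_one (Or.inl rfl)) hP hS)
          (pcell2_nonneg_endP_of_parts hq2 (partsOK_of_hasW hq0 hq1one (le_refl 0) zero_le_one hy0 hy1 hx0 hx1 (le_refl 0) zero_le_one (Or.inl rfl)) hP hS)
          (pcell2_nonneg_endP_of_parts hq2 (partsOK_of_hasW hq0 hq1one (le_refl 0) zero_le_one hy0 hy1 hx0 hx1 (le_refl 0) zero_le_one (Or.inl rfl)) hP hS)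
          (pcell2_nonneg_endP_of_parts hq2 (partsOK_of_hasW hq0 hq1one (le_refl 0) zero_le_one hy0 hy1 hx0 hx1 (le_refl 0) zero_le_one (Or.inl rfl)) hP hS)
    · exact colBD rfl
    · exact HR1 t w ht hw0 hw1
    · exact HRR t w t' v ht hw0 hw1 ht' hv0 hv1

/-! ### Measure level -/

open MeasureTheory Literature.Probability.LatticeModels Literature.Probability.Percolation
open scoped Classical

variable {V : Type*} [Fintype V]
variable {a b : V} {c : ℕ → V} {m : ℕ}
variable (hab : a ≠ b) (hinj : ∀ j k, j ≤ m → k ≤ m → c j = c k → j = k) (hca : ∀ j, j ≤ m → c j ≠ a) (hcb : ∀ j, j ≤ m → c j ≠ b)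
include hab hinj hca hcb

/-- **Cross-apex pair at rim distance three, MIN spoke pattern, `0 < q ≤ 1/2`, conditionally on the roof block.**  For a weighted double fan
(`card V = m+3`, weights supported on the double-fan pairs), `j + 3 ≤ m` and the edges `a c_{j+1}`, `b c_{j+2}` of weight `0`: if the three
roof-block cells of the rim-unsplit MIN cell function are `≥ 0` for all rims, spokes and probes in `[0,1]`, then
`φ(J_{a c_j} ∩ J_{b c_{j+3}}) ≤ φ(J_{a c_j}) · φ(J_{b c_{j+3}})`.  CONDITIONAL: the roof block is OPEN (true and certifiable pointwise; no uniform
certificate known; the letter-DNN architecture provably cannot supply one — memo §11). [cite: Grimmett2006, §3.9 eq. (3.94) (pp. 63–64)] -/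
theorem negCorr_spokes_cross_three_BA_lowq_of_roofBlock (hcard : Fintype.card V = m + 3) {q : ℝ} (hq0 : 0 < q) (hq1 : q ≤ 1 / 2)
    (HRR : ∀ r0 y r1 x r2 t w t' v : ℝ, 0 ≤ r0 → r0 ≤ 1 → 0 ≤ y → y ≤ 1 → 0 ≤ r1 → r1 ≤ 1 → 0 ≤ x → x ≤ 1 → 0 ≤ r2 → r2 ≤ 1 →
      0 ≤ t → 0 ≤ w → w ≤ 1 → 0 ≤ t' → 0 ≤ v → v ≤ 1 → 0 ≤ cellFn q [(r0, 0, y), (r1, x, 0)] r2 (roofP q t w) (roofP q t' v))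
    (HR1 : ∀ r0 y r1 x r2 t w : ℝ, 0 ≤ r0 → r0 ≤ 1 → 0 ≤ y → y ≤ 1 → 0 ≤ r1 → r1 ≤ 1 → 0 ≤ x → x ≤ 1 → 0 ≤ r2 → r2 ≤ 1 →
      0 ≤ t → 0 ≤ w → w ≤ 1 → 0 ≤ cellFn q [(r0, 0, y), (r1, x, 0)] r2 (roofP q t w) rayOne)
    (H1R : ∀ r0 y r1 x r2 t' v : ℝ, 0 ≤ r0 → r0 ≤ 1 → 0 ≤ y → y ≤ 1 → 0 ≤ r1 → r1 ≤ 1 → 0 ≤ x → x ≤ 1 → 0 ≤ r2 → r2 ≤ 1 →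
      0 ≤ t' → 0 ≤ v → v ≤ 1 → 0 ≤ cellFn q [(r0, 0, y), (r1, x, 0)] r2 rayOne (roofP q t' v))
    (w : Sym2 V → unitInterval) (hsupp : ∀ e, e ∉ dfPairs a b c m → w e = 0) {j : ℕ} (hj : j + 2 + 1 ≤ m)
    (ha : wR w s(a, c (j + 1)) = 0) (hb : wR w s(b, c (j + 2)) = 0) :
    (rcMeasureW w q ∅).real ({ω : BondConfig V | s(a, c j) ∈ ω} ∩ {ω | s(b, c (j + 2 + 1)) ∈ ω}) ≤
      (rcMeasureW w q ∅).real {ω : BondConfig V | s(a, c j) ∈ ω} *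
        (rcMeasureW w q ∅).real {ω : BondConfig V | s(b, c (j + 2 + 1)) ∈ ω} := by
  refine negCorr_spokes_cross_far_of_wordCells hab hinj hca hcb hcard hq0 (by linarith) w hsupp hj ?_
  intro _
  rw [midBlocks_two, ha, hb]
  exact cellsOK_MIN_lowq_of_roofBlock hq0.le hq1 (w _).2.1 (w _).2.2 (w _).2.1 (w _).2.2 (w _).2.1 (w _).2.2 (w _).2.1 (w _).2.2
    (w _).2.1 (w _).2.2
    (fun t w' t' v ht hw0 hw1 ht' hv0 hv1 => HRR _ _ _ _ _ t w' t' v (w _).2.1 (w _).2.2 (w _).2.1 (w _).2.2 (w _).2.1 (w _).2.2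
      (w _).2.1 (w _).2.2 (w _).2.1 (w _).2.2 ht hw0 hw1 ht' hv0 hv1)
    (fun t w' ht hw0 hw1 => HR1 _ _ _ _ _ t w' (w _).2.1 (w _).2.2 (w _).2.1 (w _).2.2 (w _).2.1 (w _).2.2 (w _).2.1 (w _).2.2
      (w _).2.1 (w _).2.2 ht hw0 hw1)
    (fun t' v ht' hv0 hv1 => H1R _ _ _ _ _ t' v (w _).2.1 (w _).2.2 (w _).2.1 (w _).2.2 (w _).2.1 (w _).2.2 (w _).2.1 (w _).2.2
      (w _).2.1 (w _).2.2 ht' hv0 hv1)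

end MinLowQ

end ThreeApex

end FK

end Summit.CriticalPhenomena.PercolationContinuityZ3.Theorems
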